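import Literature.IUT.HodgeTheaters.DiscreteProfiniteCompletionsProofs
import Literature.IUT.HodgeTheaters.DiscreteProfiniteCompletionsLattice
import Literature.IUT.HodgeTheaters.DiscreteProfiniteConjugatesFreeGroupLemmas
import Literature.IUT.HodgeTheaters.ProfiniteCompletionCentralizers
import Literature.IUT.HodgeTheaters.ProfiniteCompletionSubgroups
import Literature.GroupTheory.CombinatorialGroupTheory.FreeGroupConjugacySeparable
import HarnessLib

/-!
# [IUTchI] Theorem 2.6 (b) (nonabelian `H_G`) for `G` free, and the assembly of Theorem 2.6

Mochizuki, *Inter-universal Teichmüller theory I*, kurims manuscript (May 2020), §2, Theorem 2.6, p. 56,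
proof pp. 56–57 [cite: Mochizuki2012, Thm 2.6 pp.56-57].  This file PROVES assertion (b) — "if `H_G` is
nonabelian, then `γ ∈ F`" — for `G` free of finite rank, relative to the free case of Lemma 2.7 (iii)
(hypothesis `hIII`, in the exact shape of the named statement `FreeOrSurface.rankTwoInAbelianization`
restricted to free `G`; dischargers: abc-iut-L5-t10 / abc-iut-L5-t9), all other inputs being
kernel theorems of the tree:

* conjugacy separability of free groups ([Stb1] Thm 1, p. 57) = `FreeGroup.exists_normal_finiteIndex_not_isConj`
  (`CombinatorialGroupTheory/FreeGroupConjugacySeparable.lean`, abc-iut-L5-t14);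
* the centralizer condition `C_{F̂}(η g) = closure η(C_F(g))` for `g` in a free finite-index subgroup
  (`ProfiniteCompletionCentralizers.mem_closure_centralizer_of_commute`, abc-iut-L5-d2) — used in
  place of the instances "`N_Ĝ(H_x) = Ĥ_x`" of Lemma 2.7 (v) invoked on p. 57;
* the cyclic / abelian case of (a) and the "`γ ∈ Ĝ`" reduction (`DiscreteProfiniteCompletionsProofs`),
  the lattice step "by projecting to `Ĝ^{ab}` … `γ ∈ G`" (`DiscreteProfiniteCompletionsLattice`), and
  the free-group lemmas (centralizers cyclic, separating characters, finite rank;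
  `DiscreteProfiniteConjugatesFreeGroupLemmas`).

Route (p. 57, with the modifications noted): pick noncommuting `x, y ∈ H_G`; by (iii) pass to a finite
index `K ⊆ G` containing `u = xⁿ`, `v = yⁿ` with independent images in `K^{ab}`, whence characters
`f₁, f₂ : K → ℤ` separating them; replace `γ` by `γ' = η(f)⁻¹ γ` with trivial component at the normal
core of `K`; for `h ∈ {u, v}` conjugacy separability of the free group `K` gives `ε_h ∈ K` with
`σ_h := η(ε_h)⁻¹ γ'` CENTRALIZING `η(h)`; the centralizer condition and the components of `σ_h` (all
in `K`) put `σ_h` in the closure of `η⟨r_h⟩`, `⟨r_h⟩ = Z_K(h)`; the lattice step then shows `σ_u` is an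
INTEGER power `η(r_u^c)`, so `γ = η(f ε_u r_u^c) ∈ η(F)`.

Main results: `profiniteConjugates_b_freeCase_of_rankTwo` ((b), free case, given `hIII`) and
`profiniteConjugates_a_abelian_freeCase` ((a), abelian case, UNCONDITIONAL).  The assembly with
`hIII` discharged (Theorem 2.6 for free `G` unconditionally, Corollary 2.8 for free `Π_Z`) is in
`DiscreteProfiniteCompletionsAssembly.lean`.  Proof-only file.
-/

namespace Literature.IUT.HodgeTheaters

open scoped Pointwise
open ProfiniteCompletion

universe u

/-! ### Conjugacy separability of free groups, in the binder shape used by the Theorem 2.6 files -/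

/-- [Stb1] Theorem 1 (p. 57) as proved in the tree (`FreeGroup.exists_normal_finiteIndex_not_isConj`),
repackaged in the binder shape `∃ (K) (_ : K.Normal) (_ : K.FiniteIndex), …` consumed by
`profiniteConjugates_a_abelian_freeCase_of_conjSeparable`. [cite: Mochizuki2012, Thm 2.6 p.57] -/
theorem conjSeparable_freeGroup (ι : Type u) (u v : FreeGroup ι) (h : ¬ IsConj u v) :
    ∃ (K : Subgroup (FreeGroup ι)) (_ : K.Normal) (_ : K.FiniteIndex),
      ¬ IsConj (QuotientGroup.mk u : FreeGroup ι ⧸ K) (QuotientGroup.mk v) := by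
  obtain ⟨K, hKn, hKf, hK⟩ := FreeGroup.exists_normal_finiteIndex_not_isConj h
  exact ⟨K, hKn, hKf, hK⟩

/-- **Theorem 2.6 (a) for `H_G` abelian and `G` free of finite rank — unconditional** (conjugacy
separability of free groups being a theorem of the tree). [cite: Mochizuki2012, Thm 2.6 pp.56-57] -/
theorem profiniteConjugates_a_abelian_freeCase (F : Type u) [Group F] (G H : Subgroup F)
    [G.FiniteIndex] (hG : IsFreeOfFiniteRank G)
    (hab : ∀ x ∈ H ⊓ G, ∀ y ∈ H ⊓ G, x * y = y * x)
    (γ : profiniteCompletion F)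
    (hγ : ∀ h ∈ H, γ * toCompletion F h * γ⁻¹ ∈ (toCompletion F).range) :
    ∃ δ : F, MulAut.conj γ • (H ⊓ G).map (toCompletion F) =
      MulAut.conj (toCompletion F δ) • (H ⊓ G).map (toCompletion F) :=
  profiniteConjugates_a_abelian_freeCase_of_conjSeparable conjSeparable_freeGroup F G H hG hab γ hγ

/-! ### Theorem 2.6 (b) for `G` free of finite rank -/

section PartB

variable {F : Type u} [Group F]

/-- Reduction "`γ ∈ Ĝ`" (p. 57): some left `η(F)`-translate of `γ` has trivial component at the normal
core of the finite index subgroup `K`. [cite: Mochizuki2012, Thm 2.6 p.57] -/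
theorem exists_inv_mul_val_normalCore_eq_one (K : Subgroup F) [K.FiniteIndex]
    (γ : profiniteCompletion F) :
    ∃ f : F, ((toCompletion F f)⁻¹ * γ).val (FiniteIndexNormalSubgroup.ofSubgroup K.normalCore) = 1 := by
  set N₀ : FiniteIndexNormalSubgroup F := FiniteIndexNormalSubgroup.ofSubgroup K.normalCore with hN₀
  obtain ⟨f, hf⟩ := QuotientGroup.mk_surjective (γ.val N₀)
  refine ⟨f, ?_⟩
  change ((toCompletion F f).val N₀)⁻¹ * γ.val N₀ = 1
  rw [ProfiniteCompletion.toCompletion_val, ← hf]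
  exact inv_mul_cancel _

/-- The centralizing translate (p. 57: "since `G` is conjugacy separable … `γ ∈ G · N_Ĝ(H_x)`"): if
`γ'` has trivial component at the normal core of the free finite-index subgroup `K`, and conjugates
`η(h)` (`h ∈ K`) into `η(F)`, then `η(ε)⁻¹ γ'` commutes with `η(h)` for some `ε ∈ K`.
[cite: Mochizuki2012, Thm 2.6 p.57] -/
theorem exists_inv_mul_commute (K : Subgroup F) [K.FiniteIndex] (hK : IsFreeOfFiniteRank K)
    (γ' : profiniteCompletion F)
    (hγ' : γ'.val (FiniteIndexNormalSubgroup.ofSubgroup K.normalCore) = 1)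
    {h : F} (hhK : h ∈ K) (hconj : γ' * toCompletion F h * γ'⁻¹ ∈ (toCompletion F).range) :
    ∃ ε ∈ K, (toCompletion F ε)⁻¹ * γ' * toCompletion F h =
      toCompletion F h * ((toCompletion F ε)⁻¹ * γ') := by
  obtain ⟨g', hg'⟩ := hconj
  have hconj' : γ' * toCompletion F h * γ'⁻¹ = toCompletion F g' := hg'.symm
  have hg'K : g' ∈ K := mem_of_conj_eq_of_val_normalCore_eq_one K γ' hγ' hhK hconj'
  have hc : IsConj (⟨h, hhK⟩ : K) ⟨g', hg'K⟩ := by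
    by_contra hnc
    obtain ⟨L, hLn, hLf, hL⟩ := conjSeparable_of_isFreeOfFiniteRank conjSeparable_freeGroup K hK _ _ hnc
    exact hL (isConj_mk_of_conj_eq_of_val_normalCore_eq_one K γ' hγ' hhK hg'K hconj' L)
  obtain ⟨ε, hε⟩ := isConj_iff.mp hc
  have hε' : (ε : F) * h * (ε : F)⁻¹ = g' := by simpa using congrArg Subtype.val hε
  refine ⟨ε, ε.2, ?_⟩
  -- `γ' η(h) γ'⁻¹ = η(ε h ε⁻¹)` ⇒ `η(ε)⁻¹ γ'` commutes with `η(h)`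
  rw [← hε', map_mul, map_mul, map_inv] at hconj'
  have e1 : (toCompletion F ε)⁻¹ * γ' * toCompletion F h =
      (toCompletion F ε)⁻¹ * (γ' * toCompletion F h * γ'⁻¹) * γ' := by group
  rw [e1, hconj']
  group

/-- The components of `σ = η(ε)⁻¹ γ'` (`ε ∈ K`, `γ'` as above) all lie in `K`.
[cite: Mochizuki2012, Thm 2.6 p.57] -/
theorem exists_mem_val_eq_mk_of_inv_mul (K : Subgroup F) [K.FiniteIndex] (γ' : profiniteCompletion F)
    (hγ' : γ'.val (FiniteIndexNormalSubgroup.ofSubgroup K.normalCore) = 1) {ε : F} (hε : ε ∈ K)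
    (N : FiniteIndexNormalSubgroup F) :
    ∃ c ∈ K, @Eq (F ⧸ N.toSubgroup) (((toCompletion F ε)⁻¹ * γ').val N) (QuotientGroup.mk c) := by
  obtain ⟨c, hcK, hc⟩ := exists_mem_val_eq_mk_of_val_normalCore_eq_one K γ' hγ' N
  refine ⟨ε⁻¹ * c, K.mul_mem (K.inv_mem hε) hcK, ?_⟩
  have e : ((toCompletion F ε)⁻¹ * γ').val N = ((toCompletion F ε).val N)⁻¹ * γ'.val N := rfl
  have hc' : @Eq (F ⧸ N.toSubgroup) (γ'.val N) (QuotientGroup.mk c) := hc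
  rw [e, hc']
  rfl

/-- From the centralizer condition to the closure of the cyclic group `⟨r⟩ = Z_K(h)`: an element `σ`
with all components in `K` lying in the closure of `η(C_F(h))` lies in the closure of `η(Z_K(h))`.
[cite: Mochizuki2012, Thm 2.6 p.57] -/
theorem mem_closure_zpowers_of_mem_closure_centralizer (K : Subgroup F) [K.FiniteIndex]
    {h r : F} (hZ : ∀ c ∈ K, c * h = h * c → c ∈ Subgroup.zpowers r)
    (σ : profiniteCompletion F)
    (hσK : ∀ N : FiniteIndexNormalSubgroup F, ∃ c ∈ K, @Eq (F ⧸ N.toSubgroup) (σ.val N) (QuotientGroup.mk c))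
    (hσC : σ ∈ closure (toCompletion F '' (Subgroup.centralizer ({h} : Set F) : Set F))) :
    σ ∈ closure (toCompletion F '' (Subgroup.zpowers r : Set F)) := by
  set N₀ : FiniteIndexNormalSubgroup F := FiniteIndexNormalSubgroup.ofSubgroup K.normalCore with hN₀
  apply mem_closure_image_of_forall_val_mem
  intro N
  -- work at the level `M = N ⊓ N₀ ⊆ K`
  set M : FiniteIndexNormalSubgroup F := N ⊓ N₀ with hM
  obtain ⟨c, hcK, hc⟩ := hσK M
  obtain ⟨c₁, hc₁, hc₁'⟩ := val_mem_map_of_mem_closure hσC M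
  have hc₁eq : @Eq (F ⧸ M.toSubgroup) (σ.val M) (QuotientGroup.mk c₁) := hc₁'.symm
  -- `c₁⁻¹ c ∈ M ⊆ K`, so `c₁ ∈ K ∩ C_F(h) ⊆ ⟨r⟩`
  have hm : c₁⁻¹ * c ∈ M.toSubgroup := QuotientGroup.eq.mp (hc₁eq.symm.trans hc)
  have hmK : c₁⁻¹ * c ∈ K :=
    K.normalCore_le ((inf_le_right : M ≤ N₀) hm)
  have hc₁K : c₁ ∈ K := by
    have : c * (c₁⁻¹ * c)⁻¹ = c₁ := by group
    rw [← this]; exact K.mul_mem hcK (K.inv_mem hmK)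
  have hc₁comm : c₁ * h = h * c₁ := by
    have := Subgroup.mem_centralizer_iff.mp hc₁ h (Set.mem_singleton h)
    exact this.symm
  obtain ⟨k, hk⟩ := Subgroup.mem_zpowers_iff.mp (hZ c₁ hc₁K hc₁comm)
  -- the component at `N` is the image of `r ^ k`
  have hσN : @Eq (F ⧸ N.toSubgroup) (σ.val N) (QuotientGroup.mk (r ^ k)) :=
    val_mk_eq_of_le σ (inf_le_left : M ≤ N) (r ^ k) (by rw [hk]; exact hc₁eq)
  refine ⟨r ^ k, Subgroup.zpow_mem_zpowers r k, ?_⟩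
  rw [QuotientGroup.mk'_apply]
  exact hσN.symm

/-- **Theorem 2.6 (b) for `G` free of finite rank**, relative to the free case of Lemma 2.7 (iii)
(`hIII`, the exact shape of `FreeOrSurface.rankTwoInAbelianization` on free groups of finite rank):
with `F ⊇ G` of finite index, `G` free of finite rank, `H ⊆ F`, `γ ∈ F̂` conjugating `η(H)` into
`η(F)`, and `H_G = H ∩ G` nonabelian, `γ ∈ η(F)`.  Conjugacy separability [Stb1] and the centralizer
condition are theorems of the tree; "`H` infinite" is not needed. [cite: Mochizuki2012, Thm 2.6 pp.56-57] -/
theorem profiniteConjugates_b_freeCase_of_rankTwo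
    (hIII : ∀ (G : Type u) [Group G], IsFreeOfFiniteRank G → ∀ x y : G, x * y ≠ y * x →
      ∃ (G₁ : Subgroup G) (n : ℕ) (hx : x ^ n ∈ G₁) (hy : y ^ n ∈ G₁), G₁.FiniteIndex ∧ 0 < n ∧
        ∀ i j : ℤ, Abelianization.of (⟨x ^ n, hx⟩ : G₁) ^ i *
          Abelianization.of (⟨y ^ n, hy⟩ : G₁) ^ j = 1 → i = 0 ∧ j = 0)
    (G H : Subgroup F) [G.FiniteIndex] (hG : IsFreeOfFiniteRank G)
    (γ : profiniteCompletion F)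
    (hγ : ∀ h ∈ H, γ * toCompletion F h * γ⁻¹ ∈ (toCompletion F).range)
    (hna : ∃ x ∈ H ⊓ G, ∃ y ∈ H ⊓ G, x * y ≠ y * x) :
    γ ∈ (toCompletion F).range := by
  obtain ⟨x, hx, y, hy, hxy⟩ := hna
  obtain ⟨hxH, hxG⟩ := Subgroup.mem_inf.mp hx
  obtain ⟨hyH, hyG⟩ := Subgroup.mem_inf.mp hy
  haveI hGfree : IsFreeGroup G := FreeOrSurface.isFreeGroup_of_isFreeOfFiniteRank hG
  -- Lemma 2.7 (iii) in the free group `G`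
  have hxy' : (⟨x, hxG⟩ : G) * ⟨y, hyG⟩ ≠ ⟨y, hyG⟩ * ⟨x, hxG⟩ :=
    fun h => hxy (by simpa using congrArg Subtype.val h)
  obtain ⟨G₁, n, hxn, hyn, hG₁fi, hn, hind⟩ := hIII G hG ⟨x, hxG⟩ ⟨y, hyG⟩ hxy'
  haveI := hG₁fi
  -- the finite index subgroup `K = G₁ ⊆ F` and the elements `u = xⁿ`, `v = yⁿ`
  set K : Subgroup F := G₁.map G.subtype with hKdef
  haveI hKfi : K.FiniteIndex := by
    constructor
    rw [hKdef, Subgroup.index_map_subtype]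
    exact mul_ne_zero Subgroup.FiniteIndex.index_ne_zero Subgroup.FiniteIndex.index_ne_zero
  have hKfr : IsFreeOfFiniteRank K :=
    IsFreeOfFiniteRank.of_mulEquiv
      (Subgroup.equivMapOfInjective G₁ G.subtype (Subgroup.subtype_injective G)).symm
      (FreeOrSurface.isFreeOfFiniteRank_subgroup_of_finiteIndex G hG G₁)
  haveI hKfree : IsFreeGroup K := FreeOrSurface.isFreeGroup_of_isFreeOfFiniteRank hKfr
  set u : F := x ^ n with hu
  set v : F := y ^ n with hv
  have huK : u ∈ K := ⟨⟨x, hxG⟩ ^ n, hxn, by simp [hu]⟩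
  have hvK : v ∈ K := ⟨⟨y, hyG⟩ ^ n, hyn, by simp [hv]⟩
  have huH : u ∈ H := H.pow_mem hxH n
  have hvH : v ∈ H := H.pow_mem hyH n
  -- independence of `ū, v̄` in `K^{ab}`, transported along `e : G₁ ≃* K`
  set e : G₁ ≃* K := Subgroup.equivMapOfInjective G₁ G.subtype (Subgroup.subtype_injective G) with hedef
  have heU : e ⟨⟨x, hxG⟩ ^ n, hxn⟩ = ⟨u, huK⟩ :=
    Subtype.ext (by rw [hedef, Subgroup.coe_equivMapOfInjective_apply]; simp [hu])
  have heV : e ⟨⟨y, hyG⟩ ^ n, hyn⟩ = ⟨v, hvK⟩ :=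
    Subtype.ext (by rw [hedef, Subgroup.coe_equivMapOfInjective_apply]; simp [hv])
  have hindK : ∀ i j : ℤ, Abelianization.of (⟨u, huK⟩ : K) ^ i *
      Abelianization.of (⟨v, hvK⟩ : K) ^ j = 1 → i = 0 ∧ j = 0 := by
    intro i j hrel
    apply hind i j
    have h1 := congrArg (Abelianization.map e.symm.toMonoidHom) hrel
    rw [map_mul, map_zpow, map_zpow, Abelianization.map_of, Abelianization.map_of, map_one,
      MulEquiv.coe_toMonoidHom, ← heU, ← heV, e.symm_apply_apply, e.symm_apply_apply] at h1
    exact h1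
  have hindK' : ∀ i j : ℤ, Abelianization.of (⟨v, hvK⟩ : K) ^ i *
      Abelianization.of (⟨u, huK⟩ : K) ^ j = 1 → i = 0 ∧ j = 0 := by
    intro i j hrel
    rw [mul_comm] at hrel
    exact (hindK j i hrel).symm
  -- `u, v ≠ 1`
  have hu1 : (⟨u, huK⟩ : K) ≠ 1 := by
    intro h1
    have := (hindK 1 0 (by rw [h1]; simp)).1
    exact one_ne_zero this
  have hv1 : (⟨v, hvK⟩ : K) ≠ 1 := by
    intro h1
    have := (hindK' 1 0 (by rw [h1]; simp)).1
    exact one_ne_zero this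
  -- separating character `f₁ : K → ℤ`, `f₁(u) ≠ 0 = f₁(v)`
  obtain ⟨f₁, hf₁u, hf₁v⟩ := FreeOrSurface.exists_hom_ne_one_eq_one K ⟨u, huK⟩ ⟨v, hvK⟩ hindK
  -- the cyclic centralizers `Z_K(u) = ⟨R_u⟩`, `Z_K(v) = ⟨R_v⟩`
  obtain ⟨Ru, hRu⟩ := FreeOrSurface.exists_centralizer_eq_zpowers K ⟨u, huK⟩ hu1
  obtain ⟨Rv, hRv⟩ := FreeOrSurface.exists_centralizer_eq_zpowers K ⟨v, hvK⟩ hv1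
  have hZu : ∀ c ∈ K, c * u = u * c → c ∈ Subgroup.zpowers (Ru : F) := by
    intro c hcK hc
    have hmem : (⟨c, hcK⟩ : K) ∈ Subgroup.centralizer ({(⟨u, huK⟩ : K)} : Set K) := by
      rw [Subgroup.mem_centralizer_iff]
      intro w hw
      rw [Set.mem_singleton_iff] at hw
      subst hw
      exact Subtype.ext hc.symm
    rw [hRu] at hmem
    obtain ⟨k, hk⟩ := Subgroup.mem_zpowers_iff.mp hmem
    exact Subgroup.mem_zpowers_iff.mpr ⟨k, by simpa using congrArg Subtype.val hk⟩
  have hZv : ∀ c ∈ K, c * v = v * c → c ∈ Subgroup.zpowers (Rv : F) := by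
    intro c hcK hc
    have hmem : (⟨c, hcK⟩ : K) ∈ Subgroup.centralizer ({(⟨v, hvK⟩ : K)} : Set K) := by
      rw [Subgroup.mem_centralizer_iff]
      intro w hw
      rw [Set.mem_singleton_iff] at hw
      subst hw
      exact Subtype.ext hc.symm
    rw [hRv] at hmem
    obtain ⟨k, hk⟩ := Subgroup.mem_zpowers_iff.mp hmem
    exact Subgroup.mem_zpowers_iff.mpr ⟨k, by simpa using congrArg Subtype.val hk⟩
  -- `f₁(R_u) ≠ 0`, `f₁(R_v) = 0`
  have huRu : (⟨u, huK⟩ : K) ∈ Subgroup.zpowers Ru := by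
    rw [← hRu, Subgroup.mem_centralizer_iff]; simp
  have hvRv : (⟨v, hvK⟩ : K) ∈ Subgroup.zpowers Rv := by
    rw [← hRv, Subgroup.mem_centralizer_iff]; simp
  obtain ⟨p, hp⟩ := Subgroup.mem_zpowers_iff.mp huRu
  obtain ⟨q, hq⟩ := Subgroup.mem_zpowers_iff.mp hvRv
  have hf₁Ru : f₁ Ru ≠ 1 := FreeOrSurface.apply_root_ne_one f₁ hp hf₁u
  have hq0 : q ≠ 0 := by rintro rfl; exact hv1 (by rw [← hq, zpow_zero])
  have hf₁Rv : f₁ Rv = 1 := FreeOrSurface.apply_root_eq_one f₁ hq hq0 hf₁v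
  -- Step 1: `γ' = η(f)⁻¹ γ` with trivial component at the normal core of `K`
  obtain ⟨f, hγ'⟩ := exists_inv_mul_val_normalCore_eq_one K γ
  set γ' : profiniteCompletion F := (toCompletion F f)⁻¹ * γ with hγ'def
  have hγconj : ∀ h ∈ H, γ' * toCompletion F h * γ'⁻¹ ∈ (toCompletion F).range := by
    intro h hh
    obtain ⟨g, hg⟩ := hγ h hh
    refine ⟨f⁻¹ * g * f, ?_⟩
    rw [map_mul, map_mul, map_inv, hg, hγ'def]
    group
  -- Step 2: centralizing translates for `u` and `v`
  obtain ⟨εu, hεuK, hσu⟩ := exists_inv_mul_commute K hKfr γ' hγ' huK (hγconj u huH)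
  obtain ⟨εv, hεvK, hσv⟩ := exists_inv_mul_commute K hKfr γ' hγ' hvK (hγconj v hvH)
  set σu : profiniteCompletion F := (toCompletion F εu)⁻¹ * γ' with hσudef
  set σv : profiniteCompletion F := (toCompletion F εv)⁻¹ * γ' with hσvdef
  -- Step 3: centralizer condition ⇒ `σ_u ∈ closure η⟨R_u⟩`, `σ_v ∈ closure η⟨R_v⟩`
  have hcs := ProfiniteCompletion.hcs_of_quotient_form conjSeparable_freeGroup
  have hσuC := ProfiniteCompletion.mem_closure_centralizer_of_commute hcs F K hKfr u huK σu hσu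
  have hσvC := ProfiniteCompletion.mem_closure_centralizer_of_commute hcs F K hKfr v hvK σv hσv
  have hσuZ : σu ∈ closure (toCompletion F '' (Subgroup.zpowers (Ru : F) : Set F)) :=
    mem_closure_zpowers_of_mem_closure_centralizer K hZu σu
      (exists_mem_val_eq_mk_of_inv_mul K γ' hγ' hεuK) hσuC
  have hσvZ : σv ∈ closure (toCompletion F '' (Subgroup.zpowers (Rv : F) : Set F)) :=
    mem_closure_zpowers_of_mem_closure_centralizer K hZv σv
      (exists_mem_val_eq_mk_of_inv_mul K γ' hγ' hεvK) hσvC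
  -- Step 4: the lattice step — `σ_v σ_u⁻¹ = η(εv⁻¹ εu)` and `f₁` separate, so `σ_u = η(R_u ^ c)`
  have hrel : σv * σu⁻¹ = toCompletion F (εv⁻¹ * εu) := by
    rw [hσudef, hσvdef, map_mul, map_inv]; group
  have hf₁Ru' : f₁ ⟨(Ru : F), Ru.2⟩ ≠ 1 := by simpa using hf₁Ru
  have hf₁Rv' : f₁ ⟨(Rv : F), Rv.2⟩ = 1 := by simpa using hf₁Rv
  obtain ⟨c, hc⟩ := ProfiniteConjugates.exists_eq_toCompletion_zpow K Ru.2 Rv.2 f₁ hf₁Ru' hf₁Rv'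
    hσuZ hσvZ hrel
  -- Step 5: `γ = η(f εu R_u^c)`
  refine ⟨f * εu * (Ru : F) ^ c, ?_⟩
  have e1 : γ = toCompletion F f * (toCompletion F εu * σu) := by
    rw [hσudef, hγ'def]; group
  rw [e1, hc, map_mul, map_mul]
  group

end PartB

end Literature.IUT.HodgeTheaters
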